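import Summits.AtomisticToContinuum.HydrodynamicLimit.Theorems.OneFlightGossipEngineEnergyCurrentTailsRungHalfTubeMeanLowerPrelim
import HarnessLib

/-!
# Rung ½ for `EnergyCurrentTails` (stmt-AtomisticToContinuum-9235), seat c4, line `level-census-comparison`:
# stub B `stub_tubeMeanLower` — the static main term

The inhomogeneous version of the rung-0 pair tube mean lower bound `pair_tubeMark_mean_ge`
(`CollisionTubePairMeanLowerBound`) for the local Gibbs law with constant activity `a`, zero drift and
the hot-spot temperature `θhot x = 2 − ‖x‖ ∈ [3/2, 2]`, and the mark
`Ξ_V(n, v, w) = (1 − ‖v − Ve₁‖)₊ (1 − ‖w + Ve₁‖)₊`: the Gibbs mean of the collision-tube double sum is at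
least `(N+1) N (1 − 16λ) ε³ κ (πV/4) ∫ G_V(θhot x) G⁻_V(θhot x) dx`.

Proof: disintegrate (`lintegral_localGibbsMeasure`: positions `posGibbsMeasure`, velocities independent
`N(0, θhot xᵢ)`); on the support of the tube mark the two particles are `2ε`-close, so the partner's
Maxwellian at `xⱼ` is at least half the one at `xᵢ` (`tml_gauss_ratio`, `ε (V+1)² ≤ 1/16`); Tonelli and
shift invariance (`integral_mul_shiftInvariant`) reduce to the configurational bound
`integral_tubeMark_ge` + `posGibbs_rescaledPairEvent_ge`; finally `Θ Ξ_V v w = Ξ_V · π ‖w − v‖ ≥ π V Ξ_V`.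
The mark is written `Ξ_b` with `b = Ve₁`, `‖b‖ = V`.
-/

noncomputable section

open MeasureTheory Set Filter
open scoped ENNReal InnerProductSpace BigOperators Classical Pointwise

namespace Summit.AtomisticToContinuum.HydrodynamicLimit.Theorems.EnergyCurrentTailsRungHalf

open Literature.MathematicalPhysics.KineticTheory Literature.Analysis.FluidPDE

/-- The hot-spot temperature is positive. -/
private theorem θhot_pos' (y : T3) : 0 < 2 - ‖y‖ := by linarith [(hot_bounds y).1]

/-! ## The configurational step -/

/-- **The configurational step** (fixed velocities `p = (v, v')`): shift invariance factors out
`∫_y g_{θhot y}(v) g_{θhot y}(v')`, and the rung-0 pair lower bound `integral_tubeMark_ge` +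
`posGibbs_rescaledPairEvent_ge` bounds the remaining position average from below by
`(1 − 16λ) ε³ κ Θ Ξ_b v v' ≥ (1 − 16λ) ε³ κ π V ξ_b(v, v')`. -/
private theorem stepH {σ : ℝ} (hsd : SmallDensity uniformProfile σ) {a : ℝ} (ha : 0 < a) {N : ℕ} {V κ : ℝ}
    {b : V3} (hb : ‖b‖ = V) (hV : 2 ≤ V) (hκ : 0 ≤ κ) (hκV : 2 * (V + 1) * κ ≤ 1) (hε16 : hsDiameter σ N ≤ 1 / 16)
    (hc : 0 ≤ 1 - 16 * ovDensity uniformProfile σ) {i j : Fin (N + 1)} (hij : i ≠ j) (p : V3 × V3) :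
    ENNReal.ofReal ((1 - 16 * ovDensity uniformProfile σ) * hsDiameter σ N ^ 3 * κ * (Real.pi * V / 2) *
        ((max 0 (1 - ‖p.1 - b‖) * max 0 (1 - ‖p.2 + b‖)) *
          ∫ y : T3, localMaxwellian 1 (2 - ‖y‖) (0 : V3) p.1 * localMaxwellian 1 (2 - ‖y‖) (0 : V3) p.2)) ≤
      ∫⁻ x, ENNReal.ofReal (localMaxwellian 1 (2 - ‖x i‖) (0 : V3) p.1 * localMaxwellian 1 (2 - ‖x i‖) (0 : V3) p.2 *
        (1 / 2 * tubeMark κ (fun q : V3 × V3 × V3 => max 0 (1 - ‖q.2.1 - b‖) * max 0 (1 - ‖q.2.2 + b‖))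
          ((hsDiameter σ N)⁻¹ • Torus.reprSym (x i - x j)) p.1 p.2))
        ∂posGibbsMeasure (fun _ : T3 => a) (hsDiameter σ N) (N + 1) := by
  set ε := hsDiameter σ N with hεdef
  set c := 1 - 16 * ovDensity uniformProfile σ with hcdef
  set Ξ : V3 × V3 × V3 → ℝ := fun q => max 0 (1 - ‖q.2.1 - b‖) * max 0 (1 - ‖q.2.2 + b‖) with hΞdef
  set I : ℝ := ∫ y : T3, localMaxwellian 1 (2 - ‖y‖) (0 : V3) p.1 * localMaxwellian 1 (2 - ‖y‖) (0 : V3) p.2 with hIdef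
  have hσ := hsd.σ_pos
  have hσ2 : σ ≤ 1 / 2 := hsd.σ_lt_half.le
  have hε : 0 < ε := hsDiameter_pos hσ N
  have hV0 : 0 ≤ V := by linarith
  obtain ⟨hΞm, hΞ0, hΞ1⟩ := tml_mark_facts b
  set P := posGibbsMeasure (fun _ : T3 => a) ε (N + 1) with hPdef
  haveI hPprob : IsProbabilityMeasure P :=
    isProbabilityMeasure_posGibbsMeasure continuous_const (fun _ => ha) hσ2 N
  -- `∫⁻ ofReal h = ofReal ∫ h`
  obtain ⟨hHm, hHmem⟩ := tml_hInt_facts ε κ b i j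
  have hhm : Measurable fun x : Fin (N + 1) → T3 =>
      localMaxwellian 1 (2 - ‖x i‖) (0 : V3) p.1 * localMaxwellian 1 (2 - ‖x i‖) (0 : V3) p.2 *
        (1 / 2 * tubeMark κ Ξ (ε⁻¹ • Torus.reprSym (x i - x j)) p.1 p.2) := hHm.of_uncurry_right
  have hhi : Integrable (fun x : Fin (N + 1) → T3 =>
      localMaxwellian 1 (2 - ‖x i‖) (0 : V3) p.1 * localMaxwellian 1 (2 - ‖x i‖) (0 : V3) p.2 *
        (1 / 2 * tubeMark κ Ξ (ε⁻¹ • Torus.reprSym (x i - x j)) p.1 p.2)) P :=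
    Integrable.of_bound hhm.aestronglyMeasurable (1 / 2) (ae_of_all _ fun x => by
      rw [Real.norm_eq_abs, abs_of_nonneg (hHmem x p).1]; exact (hHmem x p).2)
  rw [← ofReal_integral_eq_lintegral_ofReal hhi (ae_of_all _ fun x => (hHmem x p).1)]
  refine ENNReal.ofReal_le_ofReal ?_
  -- shift invariance: `∫ χ(xᵢ) f(x) dP = (∫ χ) ∫ f dP`
  have hχ : Continuous fun y : T3 => localMaxwellian 1 (2 - ‖y‖) (0 : V3) p.1 * localMaxwellian 1 (2 - ‖y‖) (0 : V3) p.2 :=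
    (tml_gauss_hot p.1 p.1).1.mul (tml_gauss_hot p.2 p.2).1
  have hfm : Measurable fun x : Fin (N + 1) → T3 => 1 / 2 * tubeMark κ Ξ (ε⁻¹ • Torus.reprSym (x i - x j)) p.1 p.2 := by
    have h := (measurable_tubeMark_left κ hΞm p.1 p.2).comp (measurable_sep ε i j)
    exact measurable_const.mul h
  have hfb : ∀ x : Fin (N + 1) → T3, |1 / 2 * tubeMark κ Ξ (ε⁻¹ • Torus.reprSym (x i - x j)) p.1 p.2| ≤ 1 / 2 :=
    fun x => by
    obtain ⟨h0, h1⟩ := tml_tubeMark_mem κ b (ε⁻¹ • Torus.reprSym (x i - x j)) p.1 p.2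
    rw [abs_of_nonneg (mul_nonneg (by norm_num) h0)]
    linarith
  have hfs : ∀ (x : Fin (N + 1) → T3) (c : T3),
      1 / 2 * tubeMark κ Ξ (ε⁻¹ • Torus.reprSym ((x + fun (_ : Fin (N + 1)) => c) i -
          (x + fun (_ : Fin (N + 1)) => c) j)) p.1 p.2 =
        1 / 2 * tubeMark κ Ξ (ε⁻¹ • Torus.reprSym (x i - x j)) p.1 p.2 := fun x c => by
    simp only [Pi.add_apply, add_sub_add_right_eq_sub]
  rw [integral_mul_shiftInvariant a ε i hχ hfm hfb hfs, integral_const_mul]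
  -- the configurational lower bound for the pair (activity `a` = activity `1`)
  have hCP : ∀ S : Set V3, MeasurableSet S → S ⊆ {q | 1 < ‖q‖ ∧ ‖q‖ ≤ 1 + 2 * (V + 1) * κ} →
      c * ε ^ 3 * (volume : Measure V3).real S ≤ P.real {x | Torus.reprSym (x i - x j) ∈ ε • S} := by
    intro S hS hSsub
    rw [hPdef, posGibbsMeasure_const_eq_one ha]
    have h1 : ε * (2 * (V + 1) * κ) ≤ ε * 1 := mul_le_mul_of_nonneg_left hκV hε.le
    have hsmall : hsDiameter σ N * (1 + 2 * (V + 1) * κ) < 1 / 2 := by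
      rw [← hεdef]; nlinarith
    have h := posGibbs_rescaledPairEvent_ge hsd hij hsmall hS hSsub
    rwa [← mul_assoc] at h
  have key : c * ε ^ 3 * κ * sphereMark Ξ p.1 p.2 ≤ ∫ x, tubeMark κ Ξ (ε⁻¹ • Torus.reprSym (x i - x j)) p.1 p.2 ∂P :=
    integral_tubeMark_ge P hε i j hΞm hΞ1 hΞ0 hκ (le_refl (2 * (V + 1) * κ)) (tml_mark_speedCutoff hb) hCP p.1 p.2
  have hΘ := tml_sphereMark_mark_ge hb hV p.1 p.2
  have hI0 : 0 ≤ I := integral_nonneg fun y => ((tml_gauss_hot p.1 p.2).2 y).1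
  have hcεκ : 0 ≤ c * ε ^ 3 * κ := by positivity
  calc c * ε ^ 3 * κ * (Real.pi * V / 2) * ((max 0 (1 - ‖p.1 - b‖) * max 0 (1 - ‖p.2 + b‖)) * I)
      = I * (1 / 2 * (c * ε ^ 3 * κ * (Real.pi * V * (max 0 (1 - ‖p.1 - b‖) * max 0 (1 - ‖p.2 + b‖))))) := by ring
    _ ≤ I * (1 / 2 * (c * ε ^ 3 * κ * sphereMark Ξ p.1 p.2)) := by gcongr
    _ ≤ I * (1 / 2 * ∫ x, tubeMark κ Ξ (ε⁻¹ • Torus.reprSym (x i - x j)) p.1 p.2 ∂P) := by gcongr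

/-! ## The per-pair bound -/

/-- **One ordered pair**: `(1 − 16λ) ε³ κ (πV/2) ∫_y G_b G⁻_b ≤ E[pairTubeMark ε κ Ξ_b i j]` under the hot-spot
local Gibbs law (`1 − 16λ ≥ 0`, `‖b‖ = V`). -/
private theorem pair_bound {σ : ℝ} (hsd : SmallDensity uniformProfile σ) {a : ℝ} (ha : 0 < a) {N : ℕ}
    (Φ : HardSphereFlow (Torus.geometry (Fin 3)) (hsDiameter σ N) (N + 1)) {V κ : ℝ} {b : V3} (hb : ‖b‖ = V)
    (hV : 2 ≤ V) (hκ : 0 ≤ κ) (hκV : 2 * (V + 1) * κ ≤ 1) (hεV : hsDiameter σ N * (V + 1) ^ 2 ≤ 1 / 16)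
    (hc : 0 ≤ 1 - 16 * ovDensity uniformProfile σ) {i j : Fin (N + 1)} (hij : i ≠ j) :
    ENNReal.ofReal ((1 - 16 * ovDensity uniformProfile σ) * hsDiameter σ N ^ 3 * κ * (Real.pi * V / 2) *
        ∫ y : T3, (∫ v, max 0 (1 - ‖v - b‖) ∂gaussMeasure (0 : V3) (2 - ‖y‖)) *
          (∫ v, max 0 (1 - ‖v + b‖) ∂gaussMeasure (0 : V3) (2 - ‖y‖))) ≤
      ∫⁻ z, ENNReal.ofReal (pairTubeMark (hsDiameter σ N) κ
          (fun q : V3 × V3 × V3 => max 0 (1 - ‖q.2.1 - b‖) * max 0 (1 - ‖q.2.2 + b‖)) i j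
          (fun m => (z m).1) (fun m => (z m).2))
        ∂(localGibbsLaw σ (fun _ => a) (fun _ => (0 : V3)) (fun x => 2 - ‖x‖) N Φ) := by
  set ε := hsDiameter σ N with hεdef
  set c := 1 - 16 * ovDensity uniformProfile σ with hcdef
  set Ξ : V3 × V3 × V3 → ℝ := fun q => max 0 (1 - ‖q.2.1 - b‖) * max 0 (1 - ‖q.2.2 + b‖) with hΞdef
  have hσ := hsd.σ_pos
  have hσ2 : σ ≤ 1 / 2 := hsd.σ_lt_half.le
  have hε : 0 < ε := hsDiameter_pos hσ N
  have hV0 : 0 ≤ V := by linarith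
  have hε16 : ε ≤ 1 / 16 := by
    have h1 : (1 : ℝ) ≤ (V + 1) ^ 2 := by nlinarith
    calc ε = ε * 1 := (mul_one ε).symm
      _ ≤ ε * (V + 1) ^ 2 := mul_le_mul_of_nonneg_left h1 hε.le
      _ ≤ 1 / 16 := hεV
  have hθc : Continuous fun x : T3 => 2 - ‖x‖ := continuous_const.sub continuous_norm
  have hΞm : Measurable Ξ := (tml_mark_facts b).1
  set P := posGibbsMeasure (fun _ : T3 => a) ε (N + 1) with hPdef
  haveI hPprob : IsProbabilityMeasure P :=
    isProbabilityMeasure_posGibbsMeasure continuous_const (fun _ => ha) hσ2 N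
  set K : ℝ := c * ε ^ 3 * κ * (Real.pi * V / 2) with hKdef
  have hK0 : 0 ≤ K := by have := Real.pi_pos.le; positivity
  -- the comparison integrand (both Maxwellians at the temperature of particle `i`)
  set h : (Fin (N + 1) → T3) → V3 × V3 → ℝ := fun x p =>
    localMaxwellian 1 (2 - ‖x i‖) (0 : V3) p.1 * localMaxwellian 1 (2 - ‖x i‖) (0 : V3) p.2 *
      (1 / 2 * tubeMark κ Ξ (ε⁻¹ • Torus.reprSym (x i - x j)) p.1 p.2) with hhdef
  -- disintegration of the right-hand side
  have hGm : Measurable fun z : Config (N + 1) (Fin 3) T3 =>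
      ENNReal.ofReal (pairTubeMark ε κ Ξ i j (fun m => (z m).1) (fun m => (z m).2)) :=
    (measurable_pairTubeMark_config ε κ hΞm i j).ennreal_ofReal
  rw [localGibbsLaw_eq, lintegral_localGibbsMeasure continuous_const hθc continuous_const (fun _ => ha.le)
      θhot_pos' σ N hGm,
    canonicalPartition_eq_posPartition continuous_const hθc continuous_const (fun _ => ha.le) θhot_pos']
  simp only [zipConfig_apply]
  -- the inner velocity integral: pair marginal and densities
  have hinner : ∀ x : Fin (N + 1) → T3,
      ∫⁻ v, ENNReal.ofReal (pairTubeMark ε κ Ξ i j x v) ∂velMeasure (fun _ : T3 => (0 : V3)) (fun y => 2 - ‖y‖) x =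
        ∫⁻ p : V3 × V3, ENNReal.ofReal (localMaxwellian 1 (2 - ‖x i‖) (0 : V3) p.1 *
            localMaxwellian 1 (2 - ‖x j‖) (0 : V3) p.2) *
          ENNReal.ofReal (tubeMark κ Ξ (ε⁻¹ • Torus.reprSym (x i - x j)) p.1 p.2) := by
    intro x
    have hF : Measurable fun p : V3 × V3 => ENNReal.ofReal (tubeMark κ Ξ (ε⁻¹ • Torus.reprSym (x i - x j)) p.1 p.2) := by
      have h := (measurable_tubeMark κ hΞm).comp
        (measurable_const.prodMk measurable_id : Measurable fun p : V3 × V3 => (ε⁻¹ • Torus.reprSym (x i - x j), p))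
      exact h.ennreal_ofReal
    calc ∫⁻ v, ENNReal.ofReal (pairTubeMark ε κ Ξ i j x v) ∂velMeasure (fun _ : T3 => (0 : V3)) (fun y => 2 - ‖y‖) x
        = ∫⁻ v, (fun p : V3 × V3 => ENNReal.ofReal (tubeMark κ Ξ (ε⁻¹ • Torus.reprSym (x i - x j)) p.1 p.2))
            (v i, v j) ∂Measure.pi (fun m => gaussMeasure (0 : V3) (2 - ‖x m‖)) := rfl
      _ = _ := tml_lintegral_pi_pair (fun m => gaussMeasure (0 : V3) (2 - ‖x m‖)) hij hF
      _ = _ := tml_lintegral_prod_gauss (θhot_pos' (x i)) (θhot_pos' (x j)) hF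
  simp_rw [hinner]
  -- the pointwise velocity comparison
  have hpt : ∀ (x : Fin (N + 1) → T3) (p : V3 × V3),
      ENNReal.ofReal (h x p) ≤
        ENNReal.ofReal (localMaxwellian 1 (2 - ‖x i‖) (0 : V3) p.1 * localMaxwellian 1 (2 - ‖x j‖) (0 : V3) p.2) *
          ENNReal.ofReal (tubeMark κ Ξ (ε⁻¹ • Torus.reprSym (x i - x j)) p.1 p.2) := by
    intro x p
    have hg1 := localMaxwellian_nonneg zero_le_one (θhot_pos' (x i)).le (0 : V3) p.1
    have hg2 := localMaxwellian_nonneg zero_le_one (θhot_pos' (x j)).le (0 : V3) p.2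
    rw [← ENNReal.ofReal_mul (mul_nonneg hg1 hg2)]
    refine ENNReal.ofReal_le_ofReal ?_
    simp only [hhdef]
    obtain ⟨htm0, -⟩ := tml_tubeMark_mem κ b (ε⁻¹ • Torus.reprSym (x i - x j)) p.1 p.2
    by_cases h0 : tubeMark κ Ξ (ε⁻¹ • Torus.reprSym (x i - x j)) p.1 p.2 = 0
    · rw [h0]; simp
    · obtain ⟨hd, -, hv'⟩ := tml_tubeMark_support hb hκ hε hκV x i j h0
      have hd' : |(2 - ‖x i‖) - (2 - ‖x j‖)| ≤ 2 * ε := by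
        rw [show (2 - ‖x i‖) - (2 - ‖x j‖) = ‖x j‖ - ‖x i‖ by ring, abs_sub_comm]; exact hd
      have hcmp : 1 / 2 * localMaxwellian 1 (2 - ‖x i‖) (0 : V3) p.2 ≤ localMaxwellian 1 (2 - ‖x j‖) (0 : V3) p.2 :=
        tml_gauss_ratio _ _ _ _ _ (hot_bounds (x i)).1 (hot_bounds (x j)).1 hd' hv'.le hV0 hεV
      calc localMaxwellian 1 (2 - ‖x i‖) (0 : V3) p.1 * localMaxwellian 1 (2 - ‖x i‖) (0 : V3) p.2 *
            (1 / 2 * tubeMark κ Ξ (ε⁻¹ • Torus.reprSym (x i - x j)) p.1 p.2)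
          = localMaxwellian 1 (2 - ‖x i‖) (0 : V3) p.1 * (1 / 2 * localMaxwellian 1 (2 - ‖x i‖) (0 : V3) p.2) *
              tubeMark κ Ξ (ε⁻¹ • Torus.reprSym (x i - x j)) p.1 p.2 := by ring
        _ ≤ localMaxwellian 1 (2 - ‖x i‖) (0 : V3) p.1 * localMaxwellian 1 (2 - ‖x j‖) (0 : V3) p.2 *
              tubeMark κ Ξ (ε⁻¹ • Torus.reprSym (x i - x j)) p.1 p.2 := by gcongr
  -- measurability
  have hmeasH : Measurable (Function.uncurry h) := (tml_hInt_facts ε κ b i j).1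
  have hsw : AEMeasurable (Function.uncurry fun (x : Fin (N + 1) → T3) (p : V3 × V3) => ENNReal.ofReal (h x p))
      (P.prod (volume : Measure (V3 × V3))) :=
    (hmeasH.ennreal_ofReal).aemeasurable
  have hIm : Measurable fun x : Fin (N + 1) → T3 => ∫⁻ p : V3 × V3, ENNReal.ofReal (h x p) :=
    (hmeasH.ennreal_ofReal).lintegral_prod_right'
  have hdens : Measurable fun x : Fin (N + 1) → T3 =>
      ENNReal.ofReal ((posPartition (fun _ : T3 => a) ε (N + 1))⁻¹ * posWeight (fun _ : T3 => a) ε (N + 1) x) :=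
    (measurable_const.mul (measurable_posWeight continuous_const _ _)).ennreal_ofReal
  -- the chain
  calc ENNReal.ofReal (K * ∫ y : T3, (∫ v, max 0 (1 - ‖v - b‖) ∂gaussMeasure (0 : V3) (2 - ‖y‖)) *
          (∫ v, max 0 (1 - ‖v + b‖) ∂gaussMeasure (0 : V3) (2 - ‖y‖)))
      = ENNReal.ofReal K * ∫⁻ p : V3 × V3, ENNReal.ofReal ((max 0 (1 - ‖p.1 - b‖) * max 0 (1 - ‖p.2 + b‖)) *
          ∫ y : T3, localMaxwellian 1 (2 - ‖y‖) (0 : V3) p.1 * localMaxwellian 1 (2 - ‖y‖) (0 : V3) p.2) := by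
        rw [tml_tonelli, ← ENNReal.ofReal_mul hK0]
    _ = ∫⁻ p : V3 × V3, ENNReal.ofReal (K * ((max 0 (1 - ‖p.1 - b‖) * max 0 (1 - ‖p.2 + b‖)) *
          ∫ y : T3, localMaxwellian 1 (2 - ‖y‖) (0 : V3) p.1 * localMaxwellian 1 (2 - ‖y‖) (0 : V3) p.2)) := by
        rw [← lintegral_const_mul' _ _ ENNReal.ofReal_ne_top]
        simp_rw [ENNReal.ofReal_mul hK0]
    _ ≤ ∫⁻ p : V3 × V3, ∫⁻ x, ENNReal.ofReal (h x p) ∂P :=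
        lintegral_mono fun p => stepH hsd ha hb hV hκ hκV hε16 hc hij p
    _ = ∫⁻ x, (∫⁻ p : V3 × V3, ENNReal.ofReal (h x p)) ∂P := (lintegral_lintegral_swap hsw).symm
    _ = ∫⁻ x, ENNReal.ofReal ((posPartition (fun _ : T3 => a) ε (N + 1))⁻¹ * posWeight (fun _ : T3 => a) ε (N + 1) x) *
          ∫⁻ p : V3 × V3, ENNReal.ofReal (h x p) := by
        rw [hPdef, posGibbsMeasure, lintegral_withDensity_eq_lintegral_mul _ hdens hIm]
        rfl
    _ ≤ _ := lintegral_mono fun x => mul_le_mul_of_nonneg_left (lintegral_mono fun p => hpt x p) bot_le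

/-! ## The registered stub -/

/-- Stub B — THE STATIC MAIN TERM (inhomogeneous pair tube mean, lower bound): under the hot-spot law the
expected collision-tube double sum of the mark `Ξ_V(n,v,w) = β(v − Ve₁)β(w + Ve₁)` is at least
`(N+1)N (1−16λ) ε³ κ (πV/4) ∫ G_V(θhot x) G⁻_V(θhot x) dx` (positions: the rung-0 pair lower bound
`integral_tubeMark_ge` + `posGibbs_rescaledPairEvent_ge` + shift invariance with the continuous weight
`x ↦ g_{θhot x}(v) g_{θhot x}(w)`; velocities: the partner's Maxwellian at `xⱼ`, `dist ≤ 2ε`, is at least half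
the one at `xᵢ` on the support, by `ε(V+1)² ≤ 1/16`; `sphereMark Ξ_V v w = Ξ_V π‖v − w‖ ≥ πV Ξ_V`). -/
theorem stub_tubeMeanLower :
    ∀ (σ : ℝ), SmallDensity uniformProfile σ → ∀ (a : ℝ), 0 < a →
      ∀ (N : ℕ) (Φ : HardSphereFlow (Torus.geometry (Fin 3)) (hsDiameter σ N) (N + 1)) (V κ : ℝ),
        2 ≤ V → 0 ≤ κ → 2 * (V + 1) * κ ≤ 1 → hsDiameter σ N * (V + 1) ^ 2 ≤ 1 / 16 →
        ENNReal.ofReal (((N + 1 : ℕ) : ℝ) * N *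
            ((1 - 16 * ovDensity uniformProfile σ) * hsDiameter σ N ^ 3 * κ * (Real.pi * V / 4) *
              ∫ x : T3, (∫ v, max 0 (1 - ‖v - V • EuclideanSpace.single (0 : Fin 3) (1 : ℝ)‖)
                  ∂gaussMeasure (0 : V3) (2 - ‖x‖)) *
                (∫ v, max 0 (1 - ‖v + V • EuclideanSpace.single (0 : Fin 3) (1 : ℝ)‖)
                  ∂gaussMeasure (0 : V3) (2 - ‖x‖)))) ≤
          ∫⁻ z, ENNReal.ofReal (∑ i : Fin (N + 1), ∑ j : Fin (N + 1),
              (if i ≠ j then pairTubeMark (hsDiameter σ N) κ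
                (fun q : V3 × V3 × V3 => max 0 (1 - ‖q.2.1 - V • EuclideanSpace.single (0 : Fin 3) (1 : ℝ)‖) *
                  max 0 (1 - ‖q.2.2 + V • EuclideanSpace.single (0 : Fin 3) (1 : ℝ)‖))
                i j (fun m => (z m).1) (fun m => (z m).2) else 0))
            ∂(localGibbsLaw σ (fun _ => a) (fun _ => (0 : V3)) (fun x => 2 - ‖x‖) N Φ) := by
  intro σ hsd a ha N Φ V κ hV hκ hκV hεV
  set ε := hsDiameter σ N with hεdef
  set c := 1 - 16 * ovDensity uniformProfile σ with hcdef
  set b : V3 := V • EuclideanSpace.single (0 : Fin 3) (1 : ℝ) with hbdef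
  set Ξ : V3 × V3 × V3 → ℝ := fun q => max 0 (1 - ‖q.2.1 - b‖) * max 0 (1 - ‖q.2.2 + b‖) with hΞdef
  set I := ∫ x : T3, (∫ v, max 0 (1 - ‖v - b‖) ∂gaussMeasure (0 : V3) (2 - ‖x‖)) *
    (∫ v, max 0 (1 - ‖v + b‖) ∂gaussMeasure (0 : V3) (2 - ‖x‖)) with hIdef
  set G := localGibbsLaw σ (fun _ => a) (fun _ => (0 : V3)) (fun x => 2 - ‖x‖) N Φ with hGdef
  have hσ := hsd.σ_pos
  have hε : 0 < ε := hsDiameter_pos hσ N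
  have hV0 : 0 ≤ V := by linarith
  have hb : ‖b‖ = V := by
    rw [hbdef, norm_smul, Real.norm_of_nonneg hV0]
    simp
  have hI0 : 0 ≤ I := integral_nonneg fun y => by
    obtain ⟨⟨h0, -⟩, h2⟩ := tml_G_facts b y
    rw [h2]; exact mul_nonneg h0 h0
  have hπ := Real.pi_pos
  -- the degenerate case `1 − 16λ < 0`: the left-hand side vanishes
  by_cases hc : c < 0
  · have hb0 : ((N + 1 : ℕ) : ℝ) * N * (c * ε ^ 3 * κ * (Real.pi * V / 4) * I) ≤ 0 := by
      have h1 : 0 ≤ ε ^ 3 * κ * (Real.pi * V / 4) * I := by positivity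
      have h2 : c * ε ^ 3 * κ * (Real.pi * V / 4) * I = c * (ε ^ 3 * κ * (Real.pi * V / 4) * I) := by ring
      rw [h2]
      exact mul_nonpos_of_nonneg_of_nonpos (by positivity) (mul_nonpos_of_nonpos_of_nonneg hc.le h1)
    rw [ENNReal.ofReal_of_nonpos hb0]
    exact bot_le
  push Not at hc
  -- the summands
  have hΞm : Measurable Ξ := (tml_mark_facts b).1
  set S : Fin (N + 1) → Fin (N + 1) → Config (N + 1) (Fin 3) T3 → ℝ := fun i j z =>
    if i ≠ j then pairTubeMark ε κ Ξ i j (fun m => (z m).1) (fun m => (z m).2) else 0 with hSdef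
  have hS0 : ∀ i j z, 0 ≤ S i j z := fun i j z => by
    simp only [hSdef]
    split_ifs
    · exact (tml_tubeMark_mem _ _ _ _ _).1
    · exact le_rfl
  have hSm : ∀ i j, Measurable (S i j) := fun i j => by
    by_cases hij : i ≠ j
    · simp only [hSdef, if_pos hij]
      exact measurable_pairTubeMark_config ε κ hΞm i j
    · simp only [hSdef, if_neg hij]
      exact measurable_const
  -- linearity of the right-hand side
  have hR : ∫⁻ z, ENNReal.ofReal (∑ i, ∑ j, S i j z) ∂G = ∑ i, ∑ j, ∫⁻ z, ENNReal.ofReal (S i j z) ∂G := by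
    have e1 : ∀ z, ENNReal.ofReal (∑ i, ∑ j, S i j z) = ∑ i, ∑ j, ENNReal.ofReal (S i j z) := fun z => by
      rw [ENNReal.ofReal_sum_of_nonneg (fun i _ => Finset.sum_nonneg fun j _ => hS0 i j z)]
      exact Finset.sum_congr rfl fun i _ => ENNReal.ofReal_sum_of_nonneg fun j _ => hS0 i j z
    simp_rw [e1]
    rw [lintegral_finsetSum _ fun i _ => Finset.measurable_sum _ fun j _ => (hSm i j).ennreal_ofReal]
    exact Finset.sum_congr rfl fun i _ => lintegral_finsetSum _ fun j _ => (hSm i j).ennreal_ofReal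
  -- the per-pair bound
  set B : ℝ := c * ε ^ 3 * κ * (Real.pi * V / 4) * I with hBdef
  have hB0 : 0 ≤ B := by positivity
  have hpair : ∀ i j : Fin (N + 1),
      ENNReal.ofReal (if i ≠ j then B else 0) ≤ ∫⁻ z, ENNReal.ofReal (S i j z) ∂G := by
    intro i j
    by_cases hij : i ≠ j
    · simp only [hSdef, if_pos hij]
      refine le_trans (ENNReal.ofReal_le_ofReal ?_) (pair_bound hsd ha Φ hb hV hκ hκV hεV hc hij)
      have : c * ε ^ 3 * κ * (Real.pi * V / 2) * I - B = c * ε ^ 3 * κ * (Real.pi * V / 4) * I := by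
        rw [hBdef]; ring
      linarith
    · simp only [if_neg hij, ENNReal.ofReal_zero]
      exact bot_le
  -- summing over the ordered pairs
  calc ENNReal.ofReal (((N + 1 : ℕ) : ℝ) * N * B)
      = ENNReal.ofReal (∑ i : Fin (N + 1), ∑ j : Fin (N + 1), if i ≠ j then B else 0) := by
        rw [sum_sum_ite_ne_const]
    _ = ∑ i : Fin (N + 1), ∑ j : Fin (N + 1), ENNReal.ofReal (if i ≠ j then B else 0) := by
        rw [ENNReal.ofReal_sum_of_nonneg (fun i _ => Finset.sum_nonneg fun j _ => by
          split_ifs <;> simp [hB0])]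
        exact Finset.sum_congr rfl fun i _ => ENNReal.ofReal_sum_of_nonneg fun j _ => by
          split_ifs <;> simp [hB0]
    _ ≤ ∑ i : Fin (N + 1), ∑ j : Fin (N + 1), ∫⁻ z, ENNReal.ofReal (S i j z) ∂G :=
        Finset.sum_le_sum fun i _ => Finset.sum_le_sum fun j _ => hpair i j
    _ = ∫⁻ z, ENNReal.ofReal (∑ i, ∑ j, S i j z) ∂G := hR.symm

end Summit.AtomisticToContinuum.HydrodynamicLimit.Theorems.EnergyCurrentTailsRungHalf

end
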